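import Summits.CriticalPhenomena.SAWScalingLimit.Theses.SAWTrackTransport
import HarnessLib

/-! First lemma of crux idea `restriction-built-kernel` (stmt-CriticalPhenomena-16965): consistent conditionals on an
exhausting increasing family of events determine a unique probability measure. Abstract measure theory; provable now. -/

noncomputable section
open scoped Topology ENNReal NNReal
open MeasureTheory Filter Set
open Literature.Probability.RandomPlanarGeometry

namespace Summit.CriticalPhenomena.SAWScalingLimit.Cruxes.AxiomsOfLimit.RestrictionBuiltKernel

/-- **Gluing consistent conditionals.** `μ n` = the law of the future conditioned into the `n`-th cusped Jordan
sub-domain (a value `P D'_n` of the family), `E n = {range ⊆ closure D'_n}` increasing; restriction makes the `μ n`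
consistent (`μ n = μ m (· | E n)` in product form), positivity keeps the conditionals informative, and EXHAUSTION
(`μ m (E n) → 1` uniformly in `m ≥ n`) forces a unique probability measure `ν` carried by `⋃ E n` with
`μ n = ν (· | E n)` for all `n` — the restriction-built kernel `Q D p := ν`. [folklore] -/
theorem exists_unique_of_consistent_conditionals {X : Type*} [MeasurableSpace X] (E : ℕ → Set X)
    (hE : Monotone E) (hEm : ∀ n, MeasurableSet (E n)) (μ : ℕ → Measure X) [∀ n, IsProbabilityMeasure (μ n)]
    (hcarried : ∀ n, μ n (E n)ᶜ = 0)
    (hcons : ∀ n m, n ≤ m → ∀ T, MeasurableSet T → μ n T * μ m (E n) = μ m (T ∩ E n))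
    (hpos : ∀ n m, n ≤ m → μ m (E n) ≠ 0)
    (hexh : ∀ ε : ℝ≥0∞, 0 < ε → ∃ n, ∀ m, n ≤ m → 1 - ε ≤ μ m (E n)) :
    ∃! ν : Measure X, IsProbabilityMeasure ν ∧ ν (⋃ n, E n)ᶜ = 0 ∧
      ∀ n T, MeasurableSet T → μ n T * ν (E n) = ν (T ∩ E n) := by
  sorry

end Summit.CriticalPhenomena.SAWScalingLimit.Cruxes.AxiomsOfLimit.RestrictionBuiltKernel
end
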